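import Summits.CriticalPhenomena.CardyFormulaZ2.Theorems.CardyUniqueLimitCardyRigidityDefs
import Summits.CriticalPhenomena.CardyFormulaZ2.Theorems.CardyComplexConeParafermionToSLESixFamiliesReduction
import Literature.Probability.RandomPlanarGeometry.DrivingFunctionMeasurable
import Literature.Probability.Process.TailMoments
import HarnessLib

/-!
# The driver half of `stub_crossingMartingale` (line `crossing-martingale`, crux `CardyRigidity`)

Crux `Summit.CriticalPhenomena.CardyFormulaZ2.Theses.CardyUniqueLimit.CardyRigidity`
(stmt-CriticalPhenomena-0746), line `crossing_martingale`, registered stub `stub_crossingMartingale`: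
every subsequential limit `μ` of the bond-`ℤ²` exploration interfaces of a discretised Dobrushin
domain carries a REGULAR driving process `W` (`IsRegularDriver μ W 𝓕`: strongly adapted, continuous
paths from `0`, running suprema dominated in `L³`) with `± W` driving `μ`-a.e. curve through `φ`,
AND the level-stopped crossing observables are `𝓕`-martingales.  This file is the **driver half**
(the part not mentioning the kernel `f`), in the shape of the FK-Ising template
`LatticeModels.exists_cylinderIdentityData_of_limitData` / `…_of_latticeData`:

* `isRegularDriver_natural`, `IsRegularDriver.neg`, `isRegularDriver_smul_sign` — strongly
  measurable marginals + continuous paths from `0` + `L³` running maxima = regular driver for the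
  natural filtration; so is `-W` (the sign `s = ±1` of the stub is free);
* `exists_driverData_of_limitData`, `exists_regularDriver_of_limitData` — ONE limit law, ONE
  chordal map: Kemppainen–Smirnov's moment-free output (J₀) (a.e. describability, curves from `a`,
  convergence in distribution of continuous-path processes `V^k` to the driving function) and
  eventually-uniform sub-exponential tails of `sup_{u ≤ t} |V^k_u|` (KS Prop. 3.8) make
  `W c = drivingFunction φ c` (zeroed off the null set of curves not from `a`) a regular driver
  for its natural filtration driving `μ`-a.e. curve
  (`Process.exists_memLp_forall_abs_le_of_tendstoInDistribution` for the `L³` clause);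
* `percLimitData_of_percKSBoxData` — (J₀) for the bond-`ℤ²` interfaces of a discretisation family
  from the Kemppainen–Smirnov lattice data `PercKSBoxData` of route `CardyComplexCone` (also the
  input of crux stmt-CriticalPhenomena-11389) and `IsSubseqLimitLaw`: realising admissible meshes,
  interface laws, closed images of the KS boxes,
  `ae_isLoewnerDescribable_and_tendstoInDistribution_drivingPath_varying`, transport to
  `(BondConfig ℤ², P_{1/2})`, source clause `ae_source_eq_of_tendsto_bondInterfaceIn`;
* `exists_regularDriver_perc` (registered glue `driver_exists_regularDriver_perc`) — the DRIVER
  HALF: `PercKSBoxData` + uniform sub-exponential tails of the discrete capacity driving processes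
  read through the approximating maps (KS Prop. 3.8 for the bond-`ℤ²` exploration) ⇒ for every
  subsequential limit and chordal `φ` a regular driver `W` (and `-W`) for its natural filtration
  with `μ`-a.e. curve driven by `W`; what is left of the stub is the crossing-martingale clause.

References: Kemppainen–Smirnov, Ann. Probab. 45 (2017), Thm. 1.5, Cor. 1.7–1.8, Prop. 3.8; CDHKS,
C. R. Math. 352 (2014), Thm. 3, §3.
-/

noncomputable section

open MeasureTheory Filter Set Topology Metric
open scoped NNReal ENNReal BoundedContinuousFunction
open UpperHalfPlane (upperHalfPlaneSet)
open Literature.Probability Literature.Probability.RandomPlanarGeometry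
  Literature.Probability.LatticeModels Literature.Probability.Percolation
open scoped Literature.Probability.RandomPlanarGeometry.PathBorel
open Summit.CriticalPhenomena.CardyFormulaZ2.Cruxes.ParafermionToSLESixFamilies.CaratheodoryNetSlitUniformity
  (PercKSBoxData ae_source_eq_of_tendsto_bondInterfaceIn)

namespace Summit.CriticalPhenomena.CardyFormulaZ2.Cruxes.CardyRigidity.CrossingMartingale
export Literature.Probability.Percolation (bondInterfaceIn bondInterfaceIn_apply)  -- buildfix 2026-08-20: alias to the OLD home (names ambiguous since the Literature migration); no declaration changes
/-! ### Regular drivers: the natural filtration and the sign -/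

section Generic

variable {Ω : Type*} [MeasurableSpace Ω] {μ : Measure Ω}

/-- **A process with strongly measurable marginals, continuous paths from `0` and `L³` running
maxima is a regular driver for its natural filtration.** [folklore] -/
theorem isRegularDriver_natural {W : Ω → ℝ≥0 → ℝ}
    (hWm : ∀ t, StronglyMeasurable fun ω ↦ W ω t) (hWc : ∀ ω, Continuous (W ω))
    (hW0 : ∀ ω, W ω 0 = 0)
    (hmom : ∀ t : ℝ≥0, ∃ B : Ω → ℝ, MemLp B 3 μ ∧ (∀ ω, 0 ≤ B ω) ∧
      ∀ᵐ ω ∂μ, ∀ u, u ≤ t → |W ω u| ≤ B ω) :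
    IsRegularDriver μ W (Filtration.natural (fun t ω ↦ W ω t) hWm) :=
  ⟨Filtration.stronglyAdapted_natural hWm, hWc, hW0, hmom⟩

/-- **The negative of a regular driver is a regular driver** (same filtration): the sign
`s = ±1` in `stub_crossingMartingale` is at the disposal of the martingale half. [folklore] -/
theorem IsRegularDriver.neg {W : Ω → ℝ≥0 → ℝ} {𝓕 : Filtration ℝ≥0 ‹MeasurableSpace Ω›}
    (h : IsRegularDriver μ W 𝓕) : IsRegularDriver μ (fun ω t ↦ -W ω t) 𝓕 := by
  obtain ⟨had, hc, h0, hmom⟩ := h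
  refine ⟨fun t ↦ (had t).neg, fun ω ↦ (hc ω).neg, fun ω ↦ by simp [h0 ω], fun t ↦ ?_⟩
  obtain ⟨B, hB, hB0, hdom⟩ := hmom t
  exact ⟨B, hB, hB0, hdom.mono fun ω hω u hu ↦ by simpa only [abs_neg] using hω u hu⟩

/-- `s * W` for `s = 1 ∨ s = -1` is `W` or `-W`. [folklore] -/
theorem isRegularDriver_smul_sign {W : Ω → ℝ≥0 → ℝ} {𝓕 : Filtration ℝ≥0 ‹MeasurableSpace Ω›}
    (h : IsRegularDriver μ W 𝓕) {s : ℝ} (hs : s = 1 ∨ s = -1) :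
    IsRegularDriver μ (fun ω t ↦ s * W ω t) 𝓕 := by
  rcases hs with rfl | rfl
  · simpa only [one_mul] using h
  · simpa only [neg_mul, one_mul] using h.neg

end Generic

namespace Driver

/-! ### One limit law, one uniformizing map: driver data from (J₀) and the tails -/

section LimitData

variable {D : DobrushinDomain} {φ : ConformalEquiv upperHalfPlaneSet D.carrier}
  {μ : Measure (CurveClass ℂ)} [IsProbabilityMeasure μ]
  {Ω' : ℕ → Type*} {mΩ' : ∀ k, MeasurableSpace (Ω' k)} {P : ∀ k, Measure (Ω' k)}
  [∀ k, IsProbabilityMeasure (P k)] {V : ∀ k, ℝ≥0 → Ω' k → ℝ}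

/-- **Driver data of one subsequential limit from the moment-free Kemppainen–Smirnov data (J₀)
and the uniform tails.** Inputs, for a chordal uniformizing map `φ` of `(D; a, b)` and a
probability measure `μ` on curve classes: `μ`-a.e. curve class is describable by the Loewner
evolution through `φ` and starts at `a`; continuous-path processes `V^k` (on their own probability
spaces) converge in distribution in `C([0, ∞), ℝ)` to the driving function of the limit
(Kemppainen–Smirnov 2017, Thm. 1.5, Cor. 1.7–1.8); for every `t` the running maxima
`sup_{u ≤ t} |V^k_u|` have eventually-uniform sub-exponential tails at integer levels (KS
Prop. 3.8, eq. (19)).  Output: the process `W c = drivingFunction φ c` for curves from `a` (`0`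
otherwise) has strongly measurable marginals, continuous paths, `W 0 = 0`, running maxima on every
`[0, t]` dominated a.e. by a nonnegative `L³(μ)` function, agrees a.e. with `drivingFunction φ`, and
drives `μ`-a.e. curve through `φ`.  (The FK template `LatticeModels.exists_cylinderIdentityData_of_limitData`
without its observable clause.) [cite: KemppainenSmirnov2017, Thm. 1.5, Cor. 1.7 and Prop. 3.8] -/
theorem exists_driverData_of_limitData (hφ : D.IsChordalUniformizing φ)
    (hdesc : ∀ᵐ c ∂μ, IsLoewnerDescribable φ c) (hsrc : ∀ᵐ c ∂μ, c.source = D.pt 0)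
    (hVc : ∀ k ω, Continuous (V k · ω))
    (hlaw : TendstoInDistribution (fun k ω ↦ (⟨fun u ↦ V k u ω, hVc k ω⟩ : C(ℝ≥0, ℝ))) atTop
      (fun c ↦ (⟨drivingFunction φ c, continuous_drivingFunction φ c⟩ : C(ℝ≥0, ℝ))) P μ)
    (htail : ∀ t : ℝ≥0, ∃ (K r : ℝ) (n₀ : ℕ), 0 < r ∧ ∀ n : ℕ, n₀ ≤ n →
      ∀ᶠ k in atTop, P k {ω | ∃ u, u ≤ t ∧ (n : ℝ) < |V k u ω|} ≤
        ENNReal.ofReal (K * Real.exp (-r * n))) :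
    ∃ W : CurveClass ℂ → ℝ≥0 → ℝ,
      (∀ t, StronglyMeasurable (fun c ↦ W c t)) ∧ (∀ c, Continuous (W c)) ∧ (∀ c, W c 0 = 0) ∧
      (∀ t : ℝ≥0, ∃ M : CurveClass ℂ → ℝ, MemLp M 3 μ ∧ (∀ c, 0 ≤ M c) ∧
        ∀ᵐ c ∂μ, ∀ u, u ≤ t → |W c u| ≤ M c) ∧
      (∀ᵐ c ∂μ, W c = drivingFunction φ c) ∧
      (∀ᵐ c ∂μ, Loewner.IsDrivenBy φ.boundaryExtension (D.pt 1) (W c) c) := by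
  classical
  -- the driving function, zeroed on the (null) set of curves not starting at `a`
  set W : CurveClass ℂ → ℝ≥0 → ℝ :=
    fun c t ↦ if c.source = D.pt 0 then drivingFunction φ c t else 0 with hWdef
  have hWeq : ∀ {c : CurveClass ℂ}, c.source = D.pt 0 → W c = drivingFunction φ c := by
    intro c hc
    funext t
    simp [hWdef, hc]
  have hWae : ∀ᵐ c ∂μ, W c = drivingFunction φ c := by
    filter_upwards [hsrc] with c hc
    exact hWeq hc
  have hWm : ∀ t, StronglyMeasurable (fun c ↦ W c t) := fun t ↦
    (Measurable.ite (CurveClass.isClosed_setOf_source_eq (D.pt 0)).measurableSet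
      (measurable_drivingFunction_apply hφ t) measurable_const).stronglyMeasurable
  have hWc : ∀ c, Continuous (W c) := by
    intro c
    by_cases hc : c.source = D.pt 0
    · rw [hWeq hc]
      exact continuous_drivingFunction φ c
    · have : W c = 0 := by
        funext t
        simp [hWdef, hc]
      rw [this]
      exact continuous_const
  have hW0 : ∀ c, W c 0 = 0 := by
    intro c
    by_cases hc : c.source = D.pt 0
    · rw [hWeq hc]
      exact drivingFunction_apply_zero hφ hc
    · simp [hWdef, hc]
  -- convergence in distribution to the paths of `W`
  have hlaw' : TendstoInDistribution (fun k ω ↦ (⟨fun u ↦ V k u ω, hVc k ω⟩ : C(ℝ≥0, ℝ))) atTop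
      (fun c ↦ (⟨fun u ↦ W c u, hWc c⟩ : C(ℝ≥0, ℝ))) P μ := by
    refine hlaw.congr (fun k ↦ EventuallyEq.rfl) ?_
    filter_upwards [hWae] with c hc
    ext u
    simp [hc]
  refine ⟨W, hWm, hWc, hW0, fun t ↦ ?_, hWae, ?_⟩
  · -- the `L³` running maximum
    obtain ⟨K, r, n₀, hr, htail_t⟩ := htail t
    obtain ⟨M, hM, hM0, hbd⟩ :=
      Process.exists_memLp_forall_abs_le_of_tendstoInDistribution (W := fun t c ↦ W c t)
        (fun c ↦ hWc c) hVc hlaw' t 3 hr n₀ htail_t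
    refine ⟨M, ?_, hM0, ae_of_all _ fun c u hu ↦ hbd c u hu⟩
    simpa using hM
  · -- a.e. the curve is driven by `W c`
    filter_upwards [hdesc, hsrc] with c hd hs
    rw [hWeq hs]
    exact (isLoewnerDescribed_drivingFunction hd).2

/-- **A regular driver of one subsequential limit** (packaged form of
`exists_driverData_of_limitData`): under its hypotheses there are a process `W` and a filtration
`𝓕` — the natural filtration of `W` — with `IsRegularDriver μ W 𝓕`, `IsRegularDriver μ (-W) 𝓕`,
`W = drivingFunction φ` a.e., and `μ`-a.e. curve driven by `W` through `φ`.
[cite: KemppainenSmirnov2017, Thm. 1.5, Cor. 1.7 and Prop. 3.8] -/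
theorem exists_regularDriver_of_limitData (hφ : D.IsChordalUniformizing φ)
    (hdesc : ∀ᵐ c ∂μ, IsLoewnerDescribable φ c) (hsrc : ∀ᵐ c ∂μ, c.source = D.pt 0)
    (hVc : ∀ k ω, Continuous (V k · ω))
    (hlaw : TendstoInDistribution (fun k ω ↦ (⟨fun u ↦ V k u ω, hVc k ω⟩ : C(ℝ≥0, ℝ))) atTop
      (fun c ↦ (⟨drivingFunction φ c, continuous_drivingFunction φ c⟩ : C(ℝ≥0, ℝ))) P μ)
    (htail : ∀ t : ℝ≥0, ∃ (K r : ℝ) (n₀ : ℕ), 0 < r ∧ ∀ n : ℕ, n₀ ≤ n →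
      ∀ᶠ k in atTop, P k {ω | ∃ u, u ≤ t ∧ (n : ℝ) < |V k u ω|} ≤
        ENNReal.ofReal (K * Real.exp (-r * n))) :
    ∃ (W : CurveClass ℂ → ℝ≥0 → ℝ) (hWm : ∀ t, StronglyMeasurable (fun c ↦ W c t)),
      IsRegularDriver μ W (Filtration.natural (fun t c ↦ W c t) hWm) ∧
      IsRegularDriver μ (fun c t ↦ -W c t) (Filtration.natural (fun t c ↦ W c t) hWm) ∧
      (∀ᵐ c ∂μ, W c = drivingFunction φ c) ∧
      (∀ᵐ c ∂μ, Loewner.IsDrivenBy φ.boundaryExtension (D.pt 1) (W c) c) := by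
  obtain ⟨W, hWm, hWc, hW0, hmom, hWae, hdrv⟩ :=
    exists_driverData_of_limitData hφ hdesc hsrc hVc hlaw htail
  have hreg := isRegularDriver_natural (μ := μ) hWm hWc hW0 hmom
  exact ⟨W, hWm, hreg, hreg.neg, hWae, hdrv⟩

end LimitData

/-! ### (J₀) for the bond-`ℤ²` interfaces from the Kemppainen–Smirnov lattice data -/

section Percolation

/-- A subsequential limit law of the bond-`ℤ²` interfaces of a discretisation family is realised
along **positive, admissible** meshes `δ_k → 0` (drop finitely many terms of a realising
sequence, `ZdDiscretisationFamily.eventually_isZdAdmissible`), and is carried by curves from `a`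
(`ae_source_eq_of_tendsto_bondInterfaceIn`). [folklore] -/
theorem exists_seq_admissible_of_isSubseqLimitLaw_bond {D : DobrushinDomain}
    {E : ℝ → DiscreteDobrushin} (hE : ZdDiscretisationFamily D E) {μ : Measure (CurveClass ℂ)}
    [IsProbabilityMeasure μ]
    (hlim : IsSubseqLimitLaw (fun δ ↦ bondInterfaceIn D (E δ))
      (fun _ ↦ bondPercolation (zdGraph 2) half) μ) :
    (∀ᵐ c ∂μ, c.source = D.pt 0) ∧
    ∃ δs : ℕ → ℝ, (∀ k, 0 < δs k) ∧ Tendsto δs atTop (𝓝 0) ∧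
      (∀ k, (E (δs k)).IsZdAdmissible) ∧
      ∀ f : CurveClass ℂ →ᵇ ℝ, Tendsto (fun k ↦ ∫ ω, f (bondInterfaceIn D (E (δs k)) ω)
        ∂(bondPercolation (zdGraph 2) half)) atTop (𝓝 (∫ c, f c ∂μ)) := by
  obtain ⟨s, hs, hconv⟩ := hlim
  refine ⟨ae_source_eq_of_tendsto_bondInterfaceIn D E hE s hs μ hconv, ?_⟩
  have hpos : ∀ᶠ n in atTop, s n ∈ Ioi (0 : ℝ) := hs.eventually eventually_mem_nhdsWithin
  have hadm : ∀ᶠ n in atTop, (E (s n)).IsZdAdmissible :=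
    hs.eventually hE.eventually_isZdAdmissible
  obtain ⟨k₀, hk₀⟩ := (hpos.and hadm).exists_forall_of_atTop
  refine ⟨fun k ↦ s (k + k₀), fun k ↦ (hk₀ _ (Nat.le_add_left _ _)).1, ?_,
    fun k ↦ (hk₀ _ (Nat.le_add_left _ _)).2, fun f ↦ (hconv f).comp (tendsto_add_atTop_nat k₀)⟩
  exact (tendsto_nhds_of_tendsto_nhdsWithin hs).comp (tendsto_add_atTop_nat k₀)

/-- **(J₀) for the bond-`ℤ²` interfaces from `PercKSBoxData`.** Let `E` be a discretisation
family of the Dobrushin domain `(D; a, b)`, `μ` a subsequential limit law of the interfaces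
`bondInterfaceIn D (E δ)` under `P_{1/2}` (`IsSubseqLimitLaw`) and `φ` a chordal uniformizing map
of `D`.  Given the Kemppainen–Smirnov lattice data `PercKSBoxData` (approximating Dobrushin
domains `D_k` with chordal maps `φ_k`, boundary extensions converging to that of `φ` — (U1) on
the compacts of the closed half-plane, (U2) at infinity, `b_k → b` — and box tightness of the
interfaces read through the `φ_k`): `μ`-a.e. curve class is describable by the Loewner evolution
through `φ` and starts at `a`, and along a realising sequence of positive admissible meshes
`δ_k → 0` the capacity driving processes `V^k = drivingFunction φ_k ∘ bondInterfaceIn D (E δ_k)`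
on `(BondConfig ℤ², P_{1/2})` converge in distribution in `C([0, ∞), ℝ)` to `drivingFunction φ`
under `μ` (Kemppainen–Smirnov 2017, Thm. 1.5 and Cor. 1.7–1.8, in the tree's form
`ae_isLoewnerDescribable_and_tendstoInDistribution_drivingPath_varying`; transport to the lattice
space by `LatticeModels.tendstoInDistribution_comp_of_map_eq`).  The data `δ_k, D_k, φ_k` are
returned with their properties so that hypotheses quantified over such systems (tails, discrete
martingales) can be applied to them. [cite: KemppainenSmirnov2017, Thm. 1.5, Cor. 1.7 and Cor. 1.8]
[cite: CDHKSCRAS2014, Thm. 3 and §3] -/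
theorem percLimitData_of_percKSBoxData (hKS : PercKSBoxData) {D : DobrushinDomain}
    {E : ℝ → DiscreteDobrushin} (hE : ZdDiscretisationFamily D E) {μ : Measure (CurveClass ℂ)}
    [IsProbabilityMeasure μ]
    (hlim : IsSubseqLimitLaw (fun δ ↦ bondInterfaceIn D (E δ))
      (fun _ ↦ bondPercolation (zdGraph 2) half) μ)
    {φ : ConformalEquiv upperHalfPlaneSet D.carrier} (hφ : D.IsChordalUniformizing φ) :
    (∀ᵐ c ∂μ, IsLoewnerDescribable φ c) ∧ (∀ᵐ c ∂μ, c.source = D.pt 0) ∧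
    ∃ (δs : ℕ → ℝ) (Ds : ℕ → DobrushinDomain)
      (φs : ∀ k, ConformalEquiv upperHalfPlaneSet (Ds k).carrier),
      (∀ k, 0 < δs k) ∧ Tendsto δs atTop (𝓝 0) ∧ (∀ k, (E (δs k)).IsZdAdmissible) ∧
      (∀ k, (Ds k).IsChordalUniformizing (φs k)) ∧
      (∀ R : ℝ, TendstoUniformlyOn (fun k ↦ (φs k).boundaryExtension) φ.boundaryExtension
        atTop ({z : ℂ | 0 ≤ z.im} ∩ closedBall 0 R)) ∧
      (∀ ε : ℝ, 0 < ε → ∃ r : ℝ, ∀ᶠ k in atTop, ∀ z : ℂ, z ∈ {z : ℂ | 0 ≤ z.im} → r ≤ ‖z‖ →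
        dist ((φs k).boundaryExtension z) ((Ds k).pt 1) ≤ ε) ∧
      Tendsto (fun k ↦ (Ds k).pt 1) atTop (𝓝 (D.pt 1)) ∧
      (∀ ε : ℝ≥0∞, 0 < ε → ∃ (δγ δW : ℕ → ℝ) (T : ℕ → ℝ≥0), (∀ j, 0 < δγ j) ∧
        (∀ j, 0 < δW j) ∧
        ∀ k, bondPercolation (zdGraph 2) half ((bondInterfaceIn D (E (δs k))) ⁻¹'
          ((fun p ↦ compactifiedClass (φs k).boundaryExtension ((Ds k).pt 1) p.1) ''
            {p : C(ℝ≥0, ℂ) × C(ℝ≥0, ℝ) | p ∈ generatedPairs ∧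
              p.1 ∈ Process.modulusSet ({0} : Set ℂ) δγ ∧
              p.2 ∈ Process.modulusSet ({0} : Set ℝ) δW ∧
              ∀ (j : ℕ) (t : ℝ≥0), T j ≤ t → (j : ℝ) ≤ ‖p.1 t‖})ᶜ) ≤ ε) ∧
      TendstoInDistribution
        (fun k ω ↦ (⟨fun u ↦ drivingFunction (φs k) (bondInterfaceIn D (E (δs k)) ω) u,
          continuous_drivingFunction (φs k) (bondInterfaceIn D (E (δs k)) ω)⟩ : C(ℝ≥0, ℝ)))
        atTop (fun c ↦ (⟨drivingFunction φ c, continuous_drivingFunction φ c⟩ : C(ℝ≥0, ℝ)))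
        (fun _ ↦ bondPercolation (zdGraph 2) half) μ := by
  obtain ⟨hsrc, δs, hδpos, hδ0, hδadm, hconv⟩ := exists_seq_admissible_of_isSubseqLimitLaw_bond hE hlim
  -- the lattice data along `δs`
  obtain ⟨Ds, φs, hφs, hU1, hU2, hb, hbox⟩ := hKS D E hE φ hφ δs hδpos hδ0 hδadm
  -- the interface laws along `δs`
  set Y : ∀ k : ℕ, BondConfig (Site 2) → CurveClass ℂ := fun k ↦ bondInterfaceIn D (E (δs k))
    with hYdef
  set Pc' : Measure (BondConfig (Site 2)) := bondPercolation (zdGraph 2) half with hPc'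
  haveI hPc : IsProbabilityMeasure Pc' := by rw [hPc']; infer_instance
  have hYm : ∀ k, AEMeasurable (Y k) Pc' := fun k ↦ (measurable_bondInterfaceIn D _).aemeasurable
  set μs : ℕ → Measure (CurveClass ℂ) := fun k ↦ Pc'.map (Y k) with hμsdef
  haveI hμsP : ∀ k, IsProbabilityMeasure (μs k) := fun k ↦
    Measure.isProbabilityMeasure_map (hYm k)
  have hlim' : ∀ f : CurveClass ℂ →ᵇ ℝ,
      Tendsto (fun k ↦ ∫ c, f c ∂μs k) atTop (𝓝 (∫ c, f c ∂μ)) := by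
    intro f
    have hint : ∀ k, ∫ c, f c ∂μs k = ∫ ω, f (Y k ω) ∂Pc' := fun k ↦
      integral_map (hYm k) f.continuous.aestronglyMeasurable
    simp_rw [hint]
    exact hconv f
  -- box tightness, in the form of laws
  have hbox' : ∀ ε : ℝ≥0∞, 0 < ε → ∃ (δγ δW : ℕ → ℝ) (T : ℕ → ℝ≥0), (∀ j, 0 < δγ j) ∧
      (∀ j, 0 < δW j) ∧
      ∀ k, μs k ((fun p ↦ compactifiedClass (φs k).boundaryExtension ((Ds k).pt 1) p.1) ''
        {p : C(ℝ≥0, ℂ) × C(ℝ≥0, ℝ) | p ∈ generatedPairs ∧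
          p.1 ∈ Process.modulusSet ({0} : Set ℂ) δγ ∧ p.2 ∈ Process.modulusSet ({0} : Set ℝ) δW ∧
          ∀ (j : ℕ) (t : ℝ≥0), T j ≤ t → (j : ℝ) ≤ ‖p.1 t‖})ᶜ ≤ ε := by
    intro ε hε
    obtain ⟨δγ, δW, T, hδγ, hδW, hall⟩ := hbox ε hε
    refine ⟨δγ, δW, T, hδγ, hδW, fun k ↦ ?_⟩
    set 𝒦 : Set (C(ℝ≥0, ℂ) × C(ℝ≥0, ℝ)) := {p | p ∈ generatedPairs ∧
      p.1 ∈ Process.modulusSet ({0} : Set ℂ) δγ ∧ p.2 ∈ Process.modulusSet ({0} : Set ℝ) δW ∧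
      ∀ (j : ℕ) (t : ℝ≥0), T j ≤ t → (j : ℝ) ≤ ‖p.1 t‖} with h𝒦def
    have h𝒦 : IsCompact 𝒦 := isCompact_pairBox hδγ hδW T
    have hgen : 𝒦 ⊆ generatedPairs := fun p hp ↦ hp.1
    have htrans : ∀ r : ℝ, ∃ T' : ℝ≥0, ∀ p ∈ 𝒦, ∀ t, T' ≤ t → r ≤ ‖p.1 t‖ := fun r ↦
      ⟨T ⌈r⌉₊, fun p hp t ht ↦ (Nat.le_ceil r).trans (hp.2.2.2 _ t ht)⟩
    have hclosed : IsClosed ((fun p ↦ compactifiedClass (φs k).boundaryExtension ((Ds k).pt 1)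
        p.1) '' 𝒦) :=
      (isClosed_image_and_continuousOn_drivingPath (hφs k) h𝒦 hgen htrans).2.2.1
    change (Pc'.map (Y k)) _ ≤ ε
    rw [Measure.map_apply_of_aemeasurable (hYm k) hclosed.measurableSet.compl]
    exact hall k
  -- Kemppainen–Smirnov in approximating domains: describability and driving convergence
  obtain ⟨hdesc, hTD⟩ :=
    ae_isLoewnerDescribable_and_tendstoInDistribution_drivingPath_varying hφ hφs hU1 hU2 hb
      hlim' hbox'
  -- transport of the driving-process convergence to the lattice probability space
  have hTD' := tendstoInDistribution_comp_of_map_eq (P := fun _ ↦ Pc') hTD Y hYm fun k ↦ rfl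
  exact ⟨hdesc, hsrc, δs, Ds, φs, hδpos, hδ0, hδadm, hφs, hU1, hU2, hb, hbox, hTD'⟩

/-- **The driver half of `stub_crossingMartingale`.**  Assume the Kemppainen–Smirnov lattice
data `PercKSBoxData` for the bond-`ℤ²` interfaces, and UNIFORM SUB-EXPONENTIAL TAILS of the
running maxima of the discrete capacity driving processes read through the approximating maps:
for every Dobrushin domain, discretisation family, chordal `φ`, positive admissible meshes
`δ_k → 0` and every system `(D_k, φ_k)` of approximating Dobrushin domains with chordal maps as
produced by `PercKSBoxData` ((U1), (U2), `b_k → b`, box tightness), for every `t` there are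
`K, r > 0, n₀` with `P_{1/2}(∃ u ≤ t, |V^k_u| > n) ≤ K e^{-r n}` for all integers `n ≥ n₀` and
all large `k`, `V^k = drivingFunction φ_k ∘ bondInterfaceIn D (E δ_k)` (Kemppainen–Smirnov 2017,
Prop. 3.8, eq. (19), for the bond-`ℤ²` exploration: the output of Condition G2 = RSW).  THEN for
every subsequential limit law `μ` of the interfaces of a discretised Dobrushin domain and every
chordal uniformizing map `φ` there are a process `W` on `(CurveClass ℂ, μ)` and a filtration `𝓕`
(the natural filtration of `W`) such that `W` and `-W` are regular drivers
(`IsRegularDriver`), `W = drivingFunction φ` `μ`-a.e., and `μ`-a.e. curve class is driven by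
`W` through `φ` — the driver clauses of `stub_crossingMartingale` for either sign `s`.
[cite: KemppainenSmirnov2017, Thm. 1.5, Cor. 1.7, Cor. 1.8 and Prop. 3.8]
[cite: CamiaNewman2007, §5] -/
theorem exists_regularDriver_perc (hKS : PercKSBoxData)
    (hTail : ∀ (D : DobrushinDomain) (E : ℝ → DiscreteDobrushin), ZdDiscretisationFamily D E →
      ∀ φ : ConformalEquiv upperHalfPlaneSet D.carrier, D.IsChordalUniformizing φ →
      ∀ δs : ℕ → ℝ, (∀ k, 0 < δs k) → Tendsto δs atTop (𝓝 0) →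
        (∀ k, (E (δs k)).IsZdAdmissible) →
      ∀ (Ds : ℕ → DobrushinDomain) (φs : ∀ k, ConformalEquiv upperHalfPlaneSet (Ds k).carrier),
        (∀ k, (Ds k).IsChordalUniformizing (φs k)) →
        (∀ R : ℝ, TendstoUniformlyOn (fun k ↦ (φs k).boundaryExtension) φ.boundaryExtension
          atTop ({z : ℂ | 0 ≤ z.im} ∩ closedBall 0 R)) →
        (∀ ε : ℝ, 0 < ε → ∃ r : ℝ, ∀ᶠ k in atTop, ∀ z : ℂ, z ∈ {z : ℂ | 0 ≤ z.im} → r ≤ ‖z‖ →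
          dist ((φs k).boundaryExtension z) ((Ds k).pt 1) ≤ ε) →
        Tendsto (fun k ↦ (Ds k).pt 1) atTop (𝓝 (D.pt 1)) →
        (∀ ε : ℝ≥0∞, 0 < ε → ∃ (δγ δW : ℕ → ℝ) (T : ℕ → ℝ≥0), (∀ j, 0 < δγ j) ∧
          (∀ j, 0 < δW j) ∧
          ∀ k, bondPercolation (zdGraph 2) half ((bondInterfaceIn D (E (δs k))) ⁻¹'
            ((fun p ↦ compactifiedClass (φs k).boundaryExtension ((Ds k).pt 1) p.1) ''
              {p : C(ℝ≥0, ℂ) × C(ℝ≥0, ℝ) | p ∈ generatedPairs ∧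
                p.1 ∈ Process.modulusSet ({0} : Set ℂ) δγ ∧
                p.2 ∈ Process.modulusSet ({0} : Set ℝ) δW ∧
                ∀ (j : ℕ) (t : ℝ≥0), T j ≤ t → (j : ℝ) ≤ ‖p.1 t‖})ᶜ) ≤ ε) →
      ∀ t : ℝ≥0, ∃ (K r : ℝ) (n₀ : ℕ), 0 < r ∧ ∀ n : ℕ, n₀ ≤ n → ∀ᶠ k in atTop,
        bondPercolation (zdGraph 2) half {ω | ∃ u, u ≤ t ∧
          (n : ℝ) < |drivingFunction (φs k) (bondInterfaceIn D (E (δs k)) ω) u|} ≤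
          ENNReal.ofReal (K * Real.exp (-r * n)))
    (D : DobrushinDomain) (E : ℝ → DiscreteDobrushin) (hE : ZdDiscretisationFamily D E)
    (μ : Measure (CurveClass ℂ)) [IsProbabilityMeasure μ]
    (hlim : IsSubseqLimitLaw (fun δ ↦ bondInterfaceIn D (E δ))
      (fun _ ↦ bondPercolation (zdGraph 2) half) μ)
    (φ : ConformalEquiv upperHalfPlaneSet D.carrier) (hφ : D.IsChordalUniformizing φ) :
    ∃ (W : CurveClass ℂ → ℝ≥0 → ℝ) (hWm : ∀ t, StronglyMeasurable (fun c ↦ W c t)),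
      IsRegularDriver μ W (Filtration.natural (fun t c ↦ W c t) hWm) ∧
      IsRegularDriver μ (fun c t ↦ -W c t) (Filtration.natural (fun t c ↦ W c t) hWm) ∧
      (∀ᵐ c ∂μ, W c = drivingFunction φ c) ∧
      (∀ᵐ c ∂μ, Loewner.IsDrivenBy φ.boundaryExtension (D.pt 1) (W c) c) := by
  obtain ⟨hdesc, hsrc, δs, Ds, φs, hδpos, hδ0, hδadm, hφs, hU1, hU2, hb, hbox, hTD⟩ :=
    percLimitData_of_percKSBoxData hKS hE hlim hφ
  have htail := hTail D E hE φ hφ δs hδpos hδ0 hδadm Ds φs hφs hU1 hU2 hb hbox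
  haveI : ∀ k : ℕ, IsProbabilityMeasure ((fun _ : ℕ ↦ bondPercolation (zdGraph 2) half) k) :=
    fun _ ↦ by dsimp only; infer_instance
  exact exists_regularDriver_of_limitData (P := fun _ ↦ bondPercolation (zdGraph 2) half)
    (V := fun k u ω ↦ drivingFunction (φs k) (bondInterfaceIn D (E (δs k)) ω) u) hφ hdesc hsrc
    (fun k ω ↦ continuous_drivingFunction (φs k) (bondInterfaceIn D (E (δs k)) ω)) hTD htail

/-- **Registered form** (glue sub-goal `driver_exists_regularDriver_perc` of stmt-CriticalPhenomena-0746):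
the driver half of `stub_crossingMartingale` — `PercKSBoxData` and uniform sub-exponential tails of the
discrete capacity driving processes give a regular driver (both signs) of every subsequential limit of
the bond-`ℤ²` interfaces, driving `μ`-a.e. curve. [cite: KemppainenSmirnov2017, Thm. 1.5, Cor. 1.7, Cor. 1.8 and Prop. 3.8] -/
theorem driver_exists_regularDriver_perc : PercKSBoxData → (∀ (D : DobrushinDomain) (E : ℝ → DiscreteDobrushin), ZdDiscretisationFamily D E → ∀ φ : ConformalEquiv upperHalfPlaneSet D.carrier, D.IsChordalUniformizing φ → ∀ δs : ℕ → ℝ, (∀ k, 0 < δs k) → Filter.Tendsto δs Filter.atTop (nhds 0) → (∀ k, (E (δs k)).IsZdAdmissible) → ∀ (Ds : ℕ → DobrushinDomain) (φs : ∀ k, ConformalEquiv upperHalfPlaneSet (Ds k).carrier), (∀ k, (Ds k).IsChordalUniformizing (φs k)) → (∀ R : ℝ, TendstoUniformlyOn (fun k ↦ (φs k).boundaryExtension) φ.boundaryExtension Filter.atTop ({z : ℂ | 0 ≤ z.im} ∩ Metric.closedBall 0 R)) → (∀ ε : ℝ, 0 < ε → ∃ r : ℝ, ∀ᶠ k in Filter.atTop,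 ∀ z : ℂ, z ∈ {z : ℂ | 0 ≤ z.im} → r ≤ ‖z‖ → dist ((φs k).boundaryExtension z) ((Ds k).pt 1) ≤ ε) → Filter.Tendsto (fun k ↦ (Ds k).pt 1) Filter.atTop (nhds (D.pt 1)) → (∀ ε : ℝ≥0∞, 0 < ε → ∃ (δγ δW : ℕ → ℝ) (T : ℕ → ℝ≥0), (∀ j, 0 < δγ j) ∧ (∀ j, 0 < δW j) ∧ ∀ k, bondPercolation (zdGraph 2) half ((bondInterfaceIn D (E (δs k))) ⁻¹' ((fun p ↦ compactifiedClass (φs k).boundaryExtension ((Ds k).pt 1) p.1) '' {p : C(ℝ≥0, ℂ) × C(ℝ≥0, ℝ) | p ∈ generatedPairs ∧ p.1 ∈ Process.modulusSet ({0} : Set ℂ) δγ ∧ p.2 ∈ Process.modulusSet ({0} : Set ℝ) δW ∧ ∀ (j : ℕ) (t : ℝ≥0), T j ≤ t → (j : ℝ) ≤ ‖p.1 t‖})ᶜ) ≤ ε) → ∀ t : ℝ≥0, ∃ (K r : ℝ) (n₀ : ℕ), 0 < r ∧ ∀ n : ℕ, n₀ ≤ n → ∀ᶠ k in Filter.atTop,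 bondPercolation (zdGraph 2) half {ω | ∃ u, u ≤ t ∧ (n : ℝ) < |drivingFunction (φs k) (bondInterfaceIn D (E (δs k)) ω) u|} ≤ ENNReal.ofReal (K * Real.exp (-r * n))) → ∀ (D : DobrushinDomain) (E : ℝ → DiscreteDobrushin), ZdDiscretisationFamily D E → ∀ (μ : MeasureTheory.Measure (CurveClass ℂ)) [MeasureTheory.IsProbabilityMeasure μ], IsSubseqLimitLaw (fun δ ↦ bondInterfaceIn D (E δ)) (fun _ ↦ bondPercolation (zdGraph 2) half) μ → ∀ (φ : ConformalEquiv upperHalfPlaneSet D.carrier), D.IsChordalUniformizing φ → ∃ (W : CurveClass ℂ → ℝ≥0 → ℝ) (hWm : ∀ t, MeasureTheory.StronglyMeasurable (fun c ↦ W c t)), IsRegularDriver μ W (MeasureTheory.Filtration.natural (fun t c ↦ W c t) hWm) ∧ IsRegularDriver μ (fun c t ↦ -W c t) (MeasureTheory.Filtration.natural (fun t c ↦ W c t) hWm) ∧ (∀ᵐ c ∂μ, W c = drivingFunction φ c) ∧ (∀ᵐ c ∂μ, Loewner.IsDrivenBy φ.boundaryExtension (D.pt 1) (W c) c) :=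
  fun hKS hTail D E hE μ _ hlim φ hφ ↦ exists_regularDriver_perc hKS hTail D E hE μ hlim φ hφ

end Percolation

end Driver
end Summit.CriticalPhenomena.CardyFormulaZ2.Cruxes.CardyRigidity.CrossingMartingale

end
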